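import Literature.Analysis.FluidPDE.GaussianVortexPoincare
import Literature.Analysis.FluidPDE.GaussianVortexPlanarLinear

/-!
# Ground-state conjugation `G⁻¹ L G = Δ − ½x·∇` and the spectral gap of `L` in `L²(G⁻¹)`

Companion of `Literature.Analysis.FluidPDE.GaussianVortexPlanar` (named facts
`GallayWayne2006_thm11`, `GallayMaekawa2016_thm41`; work unit `provefact GallayMaekawa2016_thm41`).
For the linearised vorticity operator `L = Δ + ½x·∇ + 1` of Gallay–Wayne (the vendored
`strainedVorticityOperator 0`) and the Gaussian vortex `G`:

* `strainedVorticityOperator_zero_gaussian_mul` — **ground-state conjugation** (pointwise):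
  `L(Gh) = G (Δh − ½ Dh(x)[x])` for smooth `h` (Gallay–Wayne 2005, (73): `L` is conjugate to
  `Δ − |x|²/16 + ½` by `G^{1/2}`, equivalently to `Δ − ½x·∇` by `G`); in particular `LG = 0`;
* `integral_strainedVorticityOperator_mul_div_le` — **the spectral gap of `L` in
  `X = L²(G⁻¹dx)` on mean-zero vorticities, quadratic-form version**: for `w = Gh` with
  `h ∈ C^∞`, `h, Dh, D²h` bounded and `∫ w = 0`,
  `⟨Lw, w⟩_X = ∫ (Lw) w / G ≤ −½ ∫ w²/G = −½ ‖w‖²_X`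
  (Gallay–Wayne 2005, Prop. 4.1 / App. A: `σ(L) = {−n/2 : n ∈ ℕ}` in `L²(∞)`, `ker L = ℝG`;
  Gallay–Maekawa 2016, §2.2), from the Gaussian Poincaré inequality
  (`integral_sq_mul_gaussVortexProfile_le_dirichlet`, `GaussianVortexPoincare`).

## References

* Th. Gallay, C. E. Wayne, *Global stability of vortex solutions of the two-dimensional
  Navier–Stokes equation*, Comm. Math. Phys. 255 (2005), (73), Prop. 4.1, App. A.
* Th. Gallay, Y. Maekawa, *Existence and stability of viscous vortices*, arXiv:1610.08384, §2.2.
  [GallayMaekawa2016]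
-/

noncomputable section

open Set Function Filter MeasureTheory Metric
open scoped Laplacian InnerProductSpace RealInnerProductSpace ContDiff Topology

namespace Literature.Analysis.FluidPDE

/-! ### Derivatives of the Gaussian (private copies, see `GaussianVortexPlanarProofs`) -/

/-- `DG(x) = −(G(x)/2)⟪x, ·⟫`. [folklore] -/
private theorem hasFDerivAt_gauss (x : EuclideanSpace ℝ (Fin 2)) :
    HasFDerivAt gaussVortexProfile ((-(gaussVortexProfile x / 2)) • innerSL ℝ x) x := by
  have hG : gaussVortexProfile = fun ξ : EuclideanSpace ℝ (Fin 2) =>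
      (4 * Real.pi)⁻¹ * Real.exp ((-1 / 4) * ‖ξ‖ ^ 2) := by
    funext ξ; simp only [gaussVortexProfile]; ring_nf
  have h1 : HasFDerivAt (fun ξ : EuclideanSpace ℝ (Fin 2) => ‖ξ‖ ^ 2) (2 • innerSL ℝ x) x :=
    (hasStrictFDerivAt_norm_sq x).hasFDerivAt
  have h2 := ((h1.const_mul (-1 / 4 : ℝ)).exp).const_mul (4 * Real.pi)⁻¹
  rw [hG]
  refine h2.congr_fderiv ?_
  ext v
  simp
  ring

/-- `∂ᵢG(x) = −(xᵢ/2) G(x)`. [folklore] -/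
private theorem fderiv_gauss_single (x : EuclideanSpace ℝ (Fin 2)) (i : Fin 2) :
    fderiv ℝ gaussVortexProfile x (EuclideanSpace.single i (1 : ℝ)) =
      -(x i / 2) * gaussVortexProfile x := by
  rw [(hasFDerivAt_gauss x).fderiv]
  simp [EuclideanSpace.inner_single_right]
  ring

/-- The coordinate function `y ↦ yᵢ` has derivative `eᵢ* = ⟪·, eᵢ⟫`, i.e. `v ↦ vᵢ`. [folklore] -/
private theorem hasFDerivAt_coord (x : EuclideanSpace ℝ (Fin 2)) (i : Fin 2) :
    HasFDerivAt (fun y : EuclideanSpace ℝ (Fin 2) => y i)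
      (EuclideanSpace.proj i : EuclideanSpace ℝ (Fin 2) →L[ℝ] ℝ) x :=
  (EuclideanSpace.proj i : EuclideanSpace ℝ (Fin 2) →L[ℝ] ℝ).hasFDerivAt

/-! ### Ground-state conjugation -/

section GroundState

variable {h : EuclideanSpace ℝ (Fin 2) → ℝ} (hh : ContDiff ℝ ∞ h)
include hh

/-- `∂ᵢ(Gh) = G (∂ᵢh − ½xᵢ h)` as functions. [folklore] -/
theorem fderiv_gaussian_mul_apply_single (i : Fin 2) :
    (fun y => fderiv ℝ (fun z => gaussVortexProfile z * h z) y (EuclideanSpace.single i (1 : ℝ))) =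
      fun y => gaussVortexProfile y *
        (fderiv ℝ h y (EuclideanSpace.single i (1 : ℝ)) - 2⁻¹ * y i * h y) := by
  funext y
  have hG := hasFDerivAt_gauss y
  have hhd : HasFDerivAt h (fderiv ℝ h y) y := (hh.differentiable (by simp) y).hasFDerivAt
  rw [(hG.fun_mul hhd).fderiv]
  simp [EuclideanSpace.inner_single_right]
  ring

/-- `∂ᵢ∂ᵢ(Gh) = G (∂ᵢ∂ᵢh − xᵢ∂ᵢh − ½h + (xᵢ²/4) h)`. [folklore] -/
theorem fderiv_fderiv_gaussian_mul_apply_single (x : EuclideanSpace ℝ (Fin 2)) (i : Fin 2) :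
    fderiv ℝ (fun y => fderiv ℝ (fun z => gaussVortexProfile z * h z) y
        (EuclideanSpace.single i (1 : ℝ))) x (EuclideanSpace.single i (1 : ℝ)) =
      gaussVortexProfile x * (fderiv ℝ (fun y => fderiv ℝ h y (EuclideanSpace.single i (1 : ℝ))) x
        (EuclideanSpace.single i (1 : ℝ)) - x i * fderiv ℝ h x (EuclideanSpace.single i (1 : ℝ)) -
        1 / 2 * h x + x i ^ 2 / 4 * h x) := by
  rw [fderiv_gaussian_mul_apply_single hh i]
  -- the factor `ψ(y) = ∂ᵢh(y) − (yᵢ/2) h(y)` and its derivative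
  have hhd : ∀ y, HasFDerivAt h (fderiv ℝ h y) y := fun y =>
    (hh.differentiable (by simp) y).hasFDerivAt
  have hh1 : ContDiff ℝ ∞ (fun y => fderiv ℝ h y (EuclideanSpace.single i (1 : ℝ))) :=
    (hh.fderiv_right (m := ∞) (by simp)).clm_apply contDiff_const
  have hh1d : HasFDerivAt (fun y => fderiv ℝ h y (EuclideanSpace.single i (1 : ℝ)))
      (fderiv ℝ (fun y => fderiv ℝ h y (EuclideanSpace.single i (1 : ℝ))) x) x :=
    (hh1.differentiable (by simp) x).hasFDerivAt
  have hψ : HasFDerivAt (fun y : EuclideanSpace ℝ (Fin 2) =>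
      fderiv ℝ h y (EuclideanSpace.single i (1 : ℝ)) - 2⁻¹ * y i * h y)
      (fderiv ℝ (fun y => fderiv ℝ h y (EuclideanSpace.single i (1 : ℝ))) x -
        ((2⁻¹ * x i) • fderiv ℝ h x + h x • ((2⁻¹ : ℝ) •
          (EuclideanSpace.proj i : EuclideanSpace ℝ (Fin 2) →L[ℝ] ℝ)))) x :=
    hh1d.sub (((hasFDerivAt_coord x i).const_mul (2⁻¹ : ℝ)).fun_mul (hhd x))
  rw [((hasFDerivAt_gauss x).fun_mul hψ).fderiv]
  simp [EuclideanSpace.inner_single_right]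
  ring

/-- **Ground-state conjugation `G⁻¹LG = Δ − ½x·∇`** (Gallay–Wayne 2005, (73)): for smooth `h`,
`L(Gh) = G (Δh − ½ Dh(x)[x])` pointwise, where `L = Δ + ½x·∇ + 1 = strainedVorticityOperator 0`.
[cite: GallayMaekawa2016, §2.2] -/
theorem strainedVorticityOperator_zero_gaussian_mul (x : EuclideanSpace ℝ (Fin 2)) :
    strainedVorticityOperator 0 (fun y => gaussVortexProfile y * h y) x =
      gaussVortexProfile x * (Δ h x - 2⁻¹ * fderiv ℝ h x x) := by
  have hGh : ContDiff ℝ ∞ (fun y => gaussVortexProfile y * h y) := contDiff_gaussVortexProfile.mul hh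
  -- `Dh(x)[x] = x₀∂₀h + x₁∂₁h`
  have hx : fderiv ℝ h x x = x 0 * fderiv ℝ h x (EuclideanSpace.single 0 (1 : ℝ)) +
      x 1 * fderiv ℝ h x (EuclideanSpace.single 1 (1 : ℝ)) := by
    have e : x = x 0 • EuclideanSpace.single 0 (1 : ℝ) + x 1 • EuclideanSpace.single 1 (1 : ℝ) := by
      ext j; fin_cases j <;> simp
    rw [congrArg (fderiv ℝ h x) e, map_add, map_smul, map_smul, smul_eq_mul, smul_eq_mul]
  rw [strainedVorticityOperator, laplacian_eq_fin_two hGh, laplacian_eq_fin_two hh,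
    fderiv_fderiv_gaussian_mul_apply_single hh x 0, fderiv_fderiv_gaussian_mul_apply_single hh x 1,
    hx]
  have h0 := congrFun (fderiv_gaussian_mul_apply_single hh 0) x
  have h1 := congrFun (fderiv_gaussian_mul_apply_single hh 1) x
  simp only at h0 h1
  rw [h0, h1]
  ring

end GroundState

/-! ### The spectral gap of `L` in `L²(G⁻¹)` -/

/-- **Spectral gap of `L = Δ + ½x·∇ + 1` in `X = L²(G⁻¹dx)` on mean-zero vorticities**
(Gallay–Wayne 2005, Prop. 4.1 / App. A; Gallay–Maekawa 2016, §2.2), quadratic-form version: for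
`w = Gh` with `h ∈ C^∞(ℝ²)`, `h, Dh, D²h` bounded and `∫ w = 0`,
`⟨Lw, w⟩_X = ∫ (Lw)·w/G ≤ −½ ∫ w²/G = −½‖w‖²_X`. [cite: GallayMaekawa2016, §2.2] -/
theorem integral_strainedVorticityOperator_mul_div_le {h : EuclideanSpace ℝ (Fin 2) → ℝ}
    (hh : ContDiff ℝ ∞ h) {C₀ C₁ C₂ : ℝ} (h0 : ∀ z, ‖h z‖ ≤ C₀) (h1 : ∀ z, ‖fderiv ℝ h z‖ ≤ C₁)
    (h2 : ∀ z, ‖fderiv ℝ (fderiv ℝ h) z‖ ≤ C₂)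
    (hmean : ∫ x, gaussVortexProfile x * h x = 0) :
    ∫ x, strainedVorticityOperator 0 (fun y => gaussVortexProfile y * h y) x *
        (gaussVortexProfile x * h x) / gaussVortexProfile x ≤
      -2⁻¹ * ∫ x, (gaussVortexProfile x * h x) ^ 2 / gaussVortexProfile x := by
  have hmean' : ∫ x, h x * gaussVortexProfile x = 0 := by
    rw [← hmean]; congr 1; funext x; ring
  have key := integral_sq_mul_gaussVortexProfile_le_dirichlet (hh.of_le (by norm_cast))
    h0 h1 h2 hmean'
  have e1 : (fun x => strainedVorticityOperator 0 (fun y => gaussVortexProfile y * h y) x *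
      (gaussVortexProfile x * h x) / gaussVortexProfile x) =
      fun x => (Δ h x - 2⁻¹ * fderiv ℝ h x x) * h x * gaussVortexProfile x := by
    funext x
    rw [strainedVorticityOperator_zero_gaussian_mul hh]
    have := (gaussVortexProfile_pos x).ne'
    field_simp
  have e2 : (fun x => (gaussVortexProfile x * h x) ^ 2 / gaussVortexProfile x) =
      fun x => h x ^ 2 * gaussVortexProfile x := by
    funext x
    have := (gaussVortexProfile_pos x).ne'
    field_simp
  rw [e1, e2]
  linarith

end Literature.Analysis.FluidPDE
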